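import Literature.Analysis.FluidPDE.LocalLerayDifferencePressure
import HarnessLib

/-!
# Jia–Šverák 2014, proof of Thm. 3.1: the pressure pairing of the perturbation on one slice,
  local form and small radii

Analysis/FluidPDE proofs file (theorems only, no new definitions, no new named facts), part of
the proof of the named fact `Literature.Analysis.FluidPDE.jia_sverak_2014_theorem_3_2`
(`JiaSverak2014LocalRegularity.lean`; H. Jia, V. Šverák, Invent. Math. 196 (2014) =
arXiv:1204.0529, §3 Thm. 3.2). In the printed proof of Thm. 3.1 (arXiv p. 8) the local energy
of `v = u - a` on shrinking balls is iterated ("by well-known interpolation inequalities …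
`≤ C(α, m, M) t^{1/10}`"), and the pressure `q` of `v` enters through `∫∫ q v·∇φ`; the pressure
is controlled through the local expansion (Kang–Miura–Tsai 2021, Lemma 3.4) of both pressures
`p` (of `u`) and `p_K` (of `a`): the near fields differ by the bilinear Calderón–Zygmund terms,
the far fields by the far field of `(a - u) ⊗ (a + u)`, the gauges pair to zero.

The tree proves exactly this slice estimate for Lemarié-Rieusset's weak–strong uniqueness
(`slice_pressure_pairing_le`, `LocalLerayDifferencePressure.lean`: Lemarié-Rieusset 2016,
proof of Thm. 14.7, pp. 516–517), but (i) for radii `r ≥ 1` and (ii) with the far-field pairing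
bounded through the *uniformly local* energy of the difference. For the decay iteration we need
(i') radii `0 < r ≤ 1` and (ii') the far-field pairing kept *local*:
`|∫ π_far-difference · ⟨W, ψ⟩| ≤ (far-field size) · ∫_{B_r}|W| ≤ … · |B_r|^{1/2} E^{1/2}`.
This file records these variants, with the tree's proofs essentially verbatim:

* `lintegral_compl_ball_sq_mul_lt_top_of_le_one`, `integrableOn_farField_of_uloc_of_le_one`,
  `enorm_localPressureFar_sub_le_of_le_one` — the far-field tools for `0 < r ≤ 1`
  (`exists_farField_tail_le` with balls of radius `r ⊆` unit balls);
* `slice_pressure_pairing_le_local` — the slice estimate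
  `‖∫ (p₁ - p₂)⟨W, ψ⟩‖ ≤ C (m E + ε ‖W‖_{L⁶(S)} E^{1/2} + K + (m α + ε α + T_W) E^{1/2})`,
  `α = (sup_z ∫_{B(z,1)}|W|²)^{1/2}`, `T_W = ∫_{|y-x₀|≥2r}|W|²|y-x₀|⁻⁴`.

## References

* H. Jia, V. Šverák, Invent. Math. 196 (2014) = arXiv:1204.0529, §3, proof of Thm. 3.1 (p. 8).
  Bib key `JiaSverak2014`.
* P. G. Lemarié-Rieusset, *The Navier–Stokes Problem in the 21st Century* (2016), Thm. 14.7,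
  proof pp. 516–517. Bib key `LemarieRieusset2016`.
* K. Kang, H. Miura, T.-P. Tsai, IMRN 2021 = arXiv:1812.10509, Lemma 3.4 and §8. Bib key
  `KangMiuraTsai2020`.
-/

noncomputable section

open MeasureTheory TopologicalSpace Set Function Filter Metric
open _root_.Topology
open scoped ENNReal NNReal RealInnerProductSpace

namespace Literature.Analysis.FluidPDE

namespace JiaSverak2014

/-! ### Two elementary tools (private copies of those of `LocalLerayDifferencePressure`) -/

/-- **The pairing bound:** if `∫‖Q g‖ₑ ≤ M < ∞` for measurable `Q, g`, then `Q g` is integrable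
and `‖∫ Q g‖ₑ ≤ M`. [folklore] -/
private theorem integrable_and_enorm_integral_le {Q g : EuclideanSpace ℝ (Fin 3) → ℝ}
    (hQ : AEStronglyMeasurable Q volume) (hg : AEStronglyMeasurable g volume)
    {M : ℝ≥0∞} (hM : ∫⁻ x, ‖Q x * g x‖ₑ ≤ M) (hMt : M ≠ ⊤) :
    Integrable (fun x => Q x * g x) volume ∧ ‖∫ x, Q x * g x‖ₑ ≤ M :=
  ⟨⟨hQ.mul hg, lt_of_le_of_lt hM hMt.lt_top⟩, (enorm_integral_le_lintegral_enorm _).trans hM⟩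

/-- `(a + b)³ ≤ 4a³ + 4b³` in `ℝ≥0∞`. [folklore] -/
private theorem ennreal_add_pow_three_le_four_mul_add (a b : ℝ≥0∞) : (a + b) ^ (3 : ℕ) ≤ 4 * a ^ (3 : ℕ) + 4 * b ^ (3 : ℕ) := by
  have h := ENNReal.rpow_add_le_mul_rpow_add_rpow a b (by norm_num : (1 : ℝ) ≤ 3)
  have e : ∀ x : ℝ≥0∞, x ^ (3 : ℝ) = x ^ (3 : ℕ) := fun x => by
    rw [show (3 : ℝ) = ((3 : ℕ) : ℝ) by norm_num, ENNReal.rpow_natCast]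
  have e2 : (2 : ℝ≥0∞) ^ ((3 : ℝ) - 1) = 4 := by
    rw [show (3 : ℝ) - 1 = ((2 : ℕ) : ℝ) by norm_num, ENNReal.rpow_natCast]; norm_num
  rw [e, e, e, e2] at h
  calc (a + b) ^ (3 : ℕ) ≤ 4 * (a ^ (3 : ℕ) + b ^ (3 : ℕ)) := h
    _ = 4 * a ^ (3 : ℕ) + 4 * b ^ (3 : ℕ) := by ring

/-! ### Far-field tools for radii `0 < r ≤ 1` -/

/-- **Tails of a uniformly locally `L²` slice are finite, small radii:** for measurable `U` with
unit-ball energies `≤ A < ∞`, `0 < r ≤ 1` and any centre, `∫_{|y-x₀| ≥ 2r} |U|² |y-x₀|⁻⁴ < ∞`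
(`exists_farField_tail_le` with balls of radius `r`, whose energies are at most the unit-ball
ones). [folklore] -/
theorem lintegral_compl_ball_sq_mul_lt_top_of_le_one {U : EuclideanSpace ℝ (Fin 3) → EuclideanSpace ℝ (Fin 3)}
    {A : ℝ≥0∞} {r : ℝ} (hU : AEStronglyMeasurable U volume) (hAt : A ≠ ⊤)
    (hA : ∀ z : EuclideanSpace ℝ (Fin 3), ∫⁻ y in ball z 1, ‖U y‖ₑ ^ 2 ≤ A) (hr0 : 0 < r) (hr1 : r ≤ 1)
    (x₀ : EuclideanSpace ℝ (Fin 3)) :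
    ∫⁻ y in (ball x₀ (2 * r))ᶜ, ‖U y‖ₑ ^ 2 * ENNReal.ofReal ((‖y - x₀‖ ^ 4)⁻¹) < ⊤ := by
  obtain ⟨K, hKt, hK⟩ := exists_farField_tail_le (r := r) hr0
  have hAr : ∀ z : EuclideanSpace ℝ (Fin 3), ∫⁻ y in ball z r, ‖U y‖ₑ ^ 2 ≤ A := fun z =>
    (lintegral_mono_set (ball_subset_ball hr1)).trans (hA z)
  have h := hK (fun y => ‖U y‖ₑ ^ 2) (hU.enorm.pow_const 2) A hAr x₀ (2 * r) (by linarith)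
  refine lt_of_le_of_lt h ?_
  exact ENNReal.mul_lt_top (ENNReal.mul_lt_top hKt.lt_top ENNReal.ofReal_lt_top) hAt.lt_top

/-- **Absolute convergence of the far-field integrand, small radii** (`0 < r ≤ 1`, `x ∈ B_r(x₀)`,
unit-ball energies `≤ A < ∞`). [cite: KangMiuraTsai2020, §8 proof of Lemma 3.4 (pointwise bound for p_far), arXiv:1812.10509 p. 18] -/
theorem integrableOn_farField_of_uloc_of_le_one {U : EuclideanSpace ℝ (Fin 3) → EuclideanSpace ℝ (Fin 3)}
    {A : ℝ≥0∞} {x₀ x : EuclideanSpace ℝ (Fin 3)} {r : ℝ} (hU : AEStronglyMeasurable U volume) (hAt : A ≠ ⊤)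
    (hA : ∀ z : EuclideanSpace ℝ (Fin 3), ∫⁻ y in ball z 1, ‖U y‖ₑ ^ 2 ≤ A) (hr0 : 0 < r) (hr1 : r ≤ 1)
    (hx : x ∈ ball x₀ r) :
    IntegrableOn (fun y => pressureKernel (x - y) (U y) - pressureKernel (x₀ - y) (U y))
      (ball x₀ (2 * r))ᶜ volume := by
  obtain ⟨C, hC0, hC⟩ := exists_abs_pressureKernel_sub_le
  -- measurability
  have hm : AEStronglyMeasurable (fun y => pressureKernel (x - y) (U y) - pressureKernel (x₀ - y) (U y))
      (volume.restrict (ball x₀ (2 * r))ᶜ) :=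
    ((aestronglyMeasurable_pressureKernel_sub_apply hU x).sub
      (aestronglyMeasurable_pressureKernel_sub_apply hU x₀)).restrict
  -- the dominating function `C r |U|² |y-x₀|⁻⁴`
  set g : EuclideanSpace ℝ (Fin 3) → ℝ := fun y => C * r * (‖U y‖ ^ 2 * (‖y - x₀‖ ^ 4)⁻¹) with hg
  have hgm : AEStronglyMeasurable g (volume.restrict (ball x₀ (2 * r))ᶜ) := by
    have h1 : AEStronglyMeasurable (fun y => ‖U y‖ ^ 2) volume :=
      (continuous_norm.pow 2).comp_aestronglyMeasurable hU
    have h2 : AEStronglyMeasurable (fun y : EuclideanSpace ℝ (Fin 3) => (‖y - x₀‖ ^ 4)⁻¹) volume :=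
      (((continuous_norm.comp (continuous_id.sub continuous_const)).pow 4).measurable.inv).aestronglyMeasurable
    exact ((h1.mul h2).const_mul (C * r)).restrict
  have hgi : Integrable g (volume.restrict (ball x₀ (2 * r))ᶜ) := by
    refine ⟨hgm, ?_⟩
    rw [HasFiniteIntegral]
    have e : ∀ y, ‖g y‖ₑ = ENNReal.ofReal (C * r) * (‖U y‖ₑ ^ 2 * ENNReal.ofReal ((‖y - x₀‖ ^ 4)⁻¹)) := by
      intro y
      rw [hg]
      dsimp only
      have hCr : 0 ≤ C * r := by positivity
      rw [Real.enorm_eq_ofReal (by positivity), ENNReal.ofReal_mul hCr,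
        ENNReal.ofReal_mul (sq_nonneg _), ENNReal.ofReal_pow (norm_nonneg _), ofReal_norm]
    simp_rw [e]
    have hmeas : AEMeasurable (fun y => ‖U y‖ₑ ^ 2 * ENNReal.ofReal ((‖y - x₀‖ ^ 4)⁻¹))
        (volume.restrict (ball x₀ (2 * r))ᶜ) :=
      ((hU.enorm.pow_const 2).mul (measurable_ofReal_inv_norm_pow_four x₀).aemeasurable).restrict
    rw [lintegral_const_mul'' _ hmeas]
    exact ENNReal.mul_lt_top ENNReal.ofReal_lt_top
      (lintegral_compl_ball_sq_mul_lt_top_of_le_one hU hAt hA hr0 hr1 x₀)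
  refine hgi.mono' hm ?_
  refine (ae_restrict_iff' measurableSet_ball.compl).2 (Eventually.of_forall fun y hy => ?_)
  obtain ⟨h2, hy0⟩ := two_mul_norm_sub_le_of_mem hr0 hx hy
  have hxx₀ : ‖x - x₀‖ < r := by rwa [mem_ball, dist_eq_norm] at hx
  rw [Real.norm_eq_abs]
  calc |pressureKernel (x - y) (U y) - pressureKernel (x₀ - y) (U y)|
      ≤ C * ‖x - x₀‖ * ‖U y‖ ^ 2 / ‖y - x₀‖ ^ 4 := hC x₀ x y (U y) h2 hy0
    _ = C * ‖x - x₀‖ * (‖U y‖ ^ 2 * (‖y - x₀‖ ^ 4)⁻¹) := by ring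
    _ ≤ C * r * (‖U y‖ ^ 2 * (‖y - x₀‖ ^ 4)⁻¹) := by gcongr

/-- **The difference of the far fields of two fields, pointwise bound, small radii**
(Lemarié-Rieusset 2016, p. 516, the terms `S₁ + S₂`; the tree's `enorm_localPressureFar_sub_le`
for `0 < r ≤ 1`): for two measurable slices with unit-ball energies `≤ A < ∞` and `x ∈ B_r(x₀)`,
`‖π_far[U₁](x) - π_far[U₂](x)‖ ≤ C r ∫_{|y-x₀|≥2r} |U₁ - U₂| |U₁ + U₂| |y-x₀|⁻⁴ dy`.
[cite: LemarieRieusset2016, Thm. 14.7, proof (file p. 516), the terms S₁, S₂] -/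
theorem enorm_localPressureFar_sub_le_of_le_one {C : ℝ} (hC0 : 0 ≤ C)
    (hC : ∀ x₀ x y a : EuclideanSpace ℝ (Fin 3), 2 * ‖x - x₀‖ ≤ ‖y - x₀‖ → y ≠ x₀ →
      |pressureKernel (x - y) a - pressureKernel (x₀ - y) a| ≤
        C * ‖x - x₀‖ * ‖a‖ ^ 2 / ‖y - x₀‖ ^ 4)
    {u₁ u₂ : ℝ → EuclideanSpace ℝ (Fin 3) → EuclideanSpace ℝ (Fin 3)} {t : ℝ} {A : ℝ≥0∞}
    {x₀ x : EuclideanSpace ℝ (Fin 3)} {r : ℝ}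
    (hU₁ : AEStronglyMeasurable (u₁ t) volume) (hU₂ : AEStronglyMeasurable (u₂ t) volume) (hAt : A ≠ ⊤)
    (hA₁ : ∀ z : EuclideanSpace ℝ (Fin 3), ∫⁻ y in ball z 1, ‖u₁ t y‖ₑ ^ 2 ≤ A)
    (hA₂ : ∀ z : EuclideanSpace ℝ (Fin 3), ∫⁻ y in ball z 1, ‖u₂ t y‖ₑ ^ 2 ≤ A)
    (hr0 : 0 < r) (hr1 : r ≤ 1) (hx : x ∈ ball x₀ r) :
    ‖localPressureFar x₀ r u₁ t x - localPressureFar x₀ r u₂ t x‖ₑ ≤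
      ENNReal.ofReal (C * r) * ∫⁻ y in (ball x₀ (2 * r))ᶜ,
        ‖u₁ t y - u₂ t y‖ₑ * ‖u₁ t y + u₂ t y‖ₑ * ENNReal.ofReal ((‖y - x₀‖ ^ 4)⁻¹) := by
  have hxx₀ : ‖x - x₀‖ < r := by rwa [mem_ball, dist_eq_norm] at hx
  have hI₁ := integrableOn_farField_of_uloc_of_le_one hU₁ hAt hA₁ hr0 hr1 hx
  have hI₂ := integrableOn_farField_of_uloc_of_le_one hU₂ hAt hA₂ hr0 hr1 hx
  rw [localPressureFar_eq_integral, localPressureFar_eq_integral, ← integral_sub hI₁ hI₂]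
  have hpt : ∀ y, pressureKernel (x - y) (u₁ t y) - pressureKernel (x₀ - y) (u₁ t y) -
      (pressureKernel (x - y) (u₂ t y) - pressureKernel (x₀ - y) (u₂ t y)) =
      pressureForm (x - y) (u₁ t y - u₂ t y) (u₁ t y + u₂ t y) -
        pressureForm (x₀ - y) (u₁ t y - u₂ t y) (u₁ t y + u₂ t y) := by
    intro y
    rw [← pressureKernel_sub_eq_pressureForm, ← pressureKernel_sub_eq_pressureForm]
    ring
  simp_rw [hpt]
  refine (enorm_integral_le_lintegral_enorm _).trans ?_
  rw [← lintegral_const_mul' _ _ ENNReal.ofReal_ne_top]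
  refine setLIntegral_mono' measurableSet_ball.compl fun y hy => ?_
  obtain ⟨h2, hy0⟩ := two_mul_norm_sub_le_of_mem hr0 hx hy
  have hb := abs_pressureForm_sub_pressureForm_le hC0 hC h2 hy0 (u₁ t y - u₂ t y) (u₁ t y + u₂ t y)
  rw [Real.enorm_eq_ofReal_abs, ← ofReal_norm, ← ofReal_norm,
    ← ENNReal.ofReal_mul (by positivity), ← ENNReal.ofReal_mul (by positivity),
    ← ENNReal.ofReal_mul (by positivity)]
  refine ENNReal.ofReal_le_ofReal (hb.trans ?_)
  calc C * ‖x - x₀‖ * (‖u₁ t y - u₂ t y‖ * ‖u₁ t y + u₂ t y‖) / ‖y - x₀‖ ^ 4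
      = C * ‖x - x₀‖ * (‖u₁ t y - u₂ t y‖ * ‖u₁ t y + u₂ t y‖ * (‖y - x₀‖ ^ 4)⁻¹) := by ring
    _ ≤ C * r * (‖u₁ t y - u₂ t y‖ * ‖u₁ t y + u₂ t y‖ * (‖y - x₀‖ ^ 4)⁻¹) := by gcongr

/-! ### The slice estimate, local form -/

set_option maxHeartbeats 1600000 in
/-- **The pressure pairing of the difference on one time slice, local form and small radii**
(Lemarié-Rieusset 2016, proof of Thm. 14.7, pp. 516–517, spatial half of the estimates of
`∫(w·∇φ)(R₁ + R₂)` and `∫(w·∇φ)(S₁ + S₂)`; the tree's `slice_pressure_pairing_le` with the far-field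
pairing kept local). For every radius `0 < r ≤ 1` and bound `B ≥ 0` there is `C = C(r, B)` such
that, in the notation of `slice_pressure_pairing_le` (`W = U₁ - U₂`, `S = B_{2r}(x₀)`,
`E = ∫_S|W|²`, `K = ∫_S|W|³`, `α² = sup_z ∫_{B(z,1)}|W|²`, `T = ∫_{|y-x₀| ≥ 2r} |W|²|y-x₀|⁻⁴`),

  `‖∫ (p₁(t) - p₂(t)) ⟨W, ψ⟩ dx‖ ≤ C (m E + ε ‖W‖_{L⁶(S)} E^{1/2} + K + (m α + ε α + T) E^{1/2})`.

(Near field: the bilinear Calderón–Zygmund decomposition paired with `⟨W,ψ⟩ ∈ L² ∩ L³`; far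
field: `|π_far[U₁] - π_far[U₂]| ≤ Cr∫_{Sᶜ}|W|(2|U₃| + 2|U₁-U₃| + |W|)|y-x₀|⁻⁴` paired with
`|⟨W, ψ⟩| ≤ B 1_{B_r(x₀)}|W|` and `∫_{B_r}|W| ≤ |B_r|^{1/2} E^{1/2}`; the gauges pair to zero.)
[cite: LemarieRieusset2016, Thm. 14.7, proof (file pp. 516–517), estimates of ∫(w·∇φ)(R₁+R₂) and ∫(w·∇φ)(S₁+S₂)] -/
theorem slice_pressure_pairing_le_local {r B : ℝ} (hr0 : 0 < r) (hr1 : r ≤ 1) :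
    ∃ C : ℝ≥0, ∀ {u₁ u₂ u₃ : ℝ → EuclideanSpace ℝ (Fin 3) → EuclideanSpace ℝ (Fin 3)}
      {p₁ p₂ : ℝ → EuclideanSpace ℝ (Fin 3) → ℝ} {t : ℝ} {x₀ : EuclideanSpace ℝ (Fin 3)}
      {ψ : EuclideanSpace ℝ (Fin 3) → EuclideanSpace ℝ (Fin 3)} {A : ℝ≥0∞} {m ε κ₁ κ₂ : ℝ},
      AEStronglyMeasurable ψ volume → (∀ x, ‖ψ x‖ ≤ B) → (∀ x, x ∉ ball x₀ r → ψ x = 0) →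
      AEStronglyMeasurable (u₁ t) volume → AEStronglyMeasurable (u₂ t) volume →
      AEStronglyMeasurable (u₃ t) volume →
      A ≠ ⊤ → (∀ z, ∫⁻ y in ball z 1, ‖u₁ t y‖ₑ ^ 2 ≤ A) → (∀ z, ∫⁻ y in ball z 1, ‖u₂ t y‖ₑ ^ 2 ≤ A) →
      (∫⁻ y in ball x₀ (2 * r), ‖u₁ t y‖ₑ ^ (3 : ℕ) ≠ ⊤) → (∫⁻ y in ball x₀ (2 * r), ‖u₂ t y‖ₑ ^ (3 : ℕ) ≠ ⊤) →
      0 ≤ m → (∀ᵐ x ∂(volume : Measure (EuclideanSpace ℝ (Fin 3))), ‖u₃ t x‖ ≤ m) →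
      0 ≤ ε → eLpNorm (fun x => u₁ t x - u₃ t x) 3 volume ≤ ENNReal.ofReal ε →
      eLpNorm (fun x => u₁ t x - u₂ t x) 6 (volume.restrict (ball x₀ (2 * r))) ≠ ⊤ →
      (∀ᵐ x ∂(volume.restrict (ball x₀ r)),
        p₁ t x = localPressureNear x₀ r u₁ t x + localPressureFar x₀ r u₁ t x + κ₁) →
      (∀ᵐ x ∂(volume.restrict (ball x₀ r)),
        p₂ t x = localPressureNear x₀ r u₂ t x + localPressureFar x₀ r u₂ t x + κ₂) →
      AEStronglyMeasurable (localPressureFar x₀ r u₁ t) volume →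
      AEStronglyMeasurable (localPressureFar x₀ r u₂ t) volume →
      (∫ x, ⟪u₁ t x - u₂ t x, ψ x⟫ = 0) →
      ‖∫ x, (p₁ t x - p₂ t x) * ⟪u₁ t x - u₂ t x, ψ x⟫‖ₑ ≤
        C * (ENNReal.ofReal m * (∫⁻ y in ball x₀ (2 * r), ‖u₁ t y - u₂ t y‖ₑ ^ 2) +
          ENNReal.ofReal ε * eLpNorm (fun x => u₁ t x - u₂ t x) 6 (volume.restrict (ball x₀ (2 * r))) *
            (∫⁻ y in ball x₀ (2 * r), ‖u₁ t y - u₂ t y‖ₑ ^ 2) ^ (1 / 2 : ℝ) +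
          (∫⁻ y in ball x₀ (2 * r), ‖u₁ t y - u₂ t y‖ₑ ^ (3 : ℕ)) +
          (ENNReal.ofReal m * (⨆ z : EuclideanSpace ℝ (Fin 3), ∫⁻ y in ball z 1, ‖u₁ t y - u₂ t y‖ₑ ^ 2) ^ (1 / 2 : ℝ) +
            ENNReal.ofReal ε * (⨆ z : EuclideanSpace ℝ (Fin 3), ∫⁻ y in ball z 1, ‖u₁ t y - u₂ t y‖ₑ ^ 2) ^ (1 / 2 : ℝ) +
            ∫⁻ y in (ball x₀ (2 * r))ᶜ, ‖u₁ t y - u₂ t y‖ₑ ^ 2 * ENNReal.ofReal ((‖y - x₀‖ ^ 4)⁻¹)) *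
            (∫⁻ y in ball x₀ (2 * r), ‖u₁ t y - u₂ t y‖ₑ ^ 2) ^ (1 / 2 : ℝ)) := by
  -- ## the constants
  obtain ⟨Ccz, hCcz⟩ := exists_normalisedPressure_sub_eq_add₃
  obtain ⟨CK, hCK0, hCK⟩ := exists_abs_pressureKernel_sub_le
  obtain ⟨Kt, hKtt, hKtail⟩ := exists_farField_tail_le (r := r) hr0
  obtain ⟨N, hN⟩ := exists_lintegral_ball_le_mul_iSup (E := EuclideanSpace ℝ (Fin 3)) (2 * r)
  set V₁ : ℝ≥0∞ := volume (ball (0 : EuclideanSpace ℝ (Fin 3)) r) with hV₁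
  set Vr : ℝ≥0∞ := volume (ball (0 : EuclideanSpace ℝ (Fin 3)) r) with hVr
  have hV₁t : V₁ ≠ ⊤ := measure_ball_lt_top.ne
  have hVrt : Vr ≠ ⊤ := measure_ball_lt_top.ne
  set Bₑ : ℝ≥0∞ := ENNReal.ofReal B with hBₑ
  set cK : ℝ≥0∞ := ENNReal.ofReal (CK * r) with hcK
  set τ : ℝ≥0∞ := Kt * ENNReal.ofReal ((2 * r - r)⁻¹) with hτ
  have hτt : τ ≠ ⊤ := ENNReal.mul_ne_top hKtt ENNReal.ofReal_ne_top
  -- near-field constant, far-field constant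
  set Cn : ℝ≥0∞ := (Ccz : ℝ≥0∞) * Bₑ with hCn
  set Cf : ℝ≥0∞ := cK * (2 * τ * V₁ ^ (1 / 2 : ℝ) + 2 * τ * V₁ ^ (1 / 6 : ℝ) + 1) * (Bₑ * Vr ^ (1 / 2 : ℝ)) with hCf
  set C : ℝ≥0∞ := Cn + Cf + 1 with hC
  have hCt : C ≠ ⊤ := by
    simp only [hC, hCn, hCf, hcK, hBₑ]
    have : V₁ ^ (1 / 2 : ℝ) ≠ ⊤ := ENNReal.rpow_ne_top_of_nonneg (by norm_num) hV₁t
    have : V₁ ^ (1 / 6 : ℝ) ≠ ⊤ := ENNReal.rpow_ne_top_of_nonneg (by norm_num) hV₁t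
    have : Vr ^ (1 / 2 : ℝ) ≠ ⊤ := ENNReal.rpow_ne_top_of_nonneg (by norm_num) hVrt
    finiteness
  refine ⟨C.toNNReal, ?_⟩
  intro u₁ u₂ u₃ p₁ p₂ t x₀ ψ A m ε κ₁ κ₂ hψm hψB hψ0 hu₁ hu₂ hu₃ hAt hA₁ hA₂ h3₁ h3₂ hm hm₃ hε hε₄ h6
    hrep₁ hrep₂ hF₁ hF₂ hdiv
  rw [ENNReal.coe_toNNReal hCt]
  -- ## abbreviations
  set S : Set (EuclideanSpace ℝ (Fin 3)) := ball x₀ (2 * r) with hS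
  have hSm : MeasurableSet S := measurableSet_ball
  set W : EuclideanSpace ℝ (Fin 3) → EuclideanSpace ℝ (Fin 3) := fun x => u₁ t x - u₂ t x with hW
  have hWm : AEStronglyMeasurable W volume := hu₁.sub hu₂
  set g : EuclideanSpace ℝ (Fin 3) → ℝ := fun x => ⟪W x, ψ x⟫ with hg
  have hgm : AEStronglyMeasurable g volume := hWm.inner hψm
  set E : ℝ≥0∞ := ∫⁻ y in S, ‖W y‖ₑ ^ 2 with hE
  set K : ℝ≥0∞ := ∫⁻ y in S, ‖W y‖ₑ ^ (3 : ℕ) with hK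
  set α2 : ℝ≥0∞ := ⨆ z : EuclideanSpace ℝ (Fin 3), ∫⁻ y in ball z 1, ‖W y‖ₑ ^ 2 with hα2
  set TW : ℝ≥0∞ := ∫⁻ y in Sᶜ, ‖W y‖ₑ ^ 2 * ENNReal.ofReal ((‖y - x₀‖ ^ 4)⁻¹) with hTW
  set L6 : ℝ≥0∞ := eLpNorm W 6 (volume.restrict S) with hL6
  have hBr_S : ball x₀ r ⊆ S := ball_subset_ball (by linarith)
  -- ## finiteness of the slice quantities
  have hα2A : α2 ≤ 2 * A + 2 * A := by
    refine iSup_le fun z => ?_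
    calc ∫⁻ y in ball z 1, ‖W y‖ₑ ^ 2 ≤ ∫⁻ y in ball z 1, (2 * ‖u₁ t y‖ₑ ^ 2 + 2 * ‖u₂ t y‖ₑ ^ 2) := by
          refine lintegral_mono fun y => ?_
          calc ‖W y‖ₑ ^ 2 ≤ (‖u₁ t y‖ₑ + ‖u₂ t y‖ₑ) ^ 2 := by
                gcongr
                exact enorm_sub_le
            _ ≤ 2 * ‖u₁ t y‖ₑ ^ 2 + 2 * ‖u₂ t y‖ₑ ^ 2 := PoincareBall.add_sq_le_two_mul_sq_add _ _
      _ = (2 * ∫⁻ y in ball z 1, ‖u₁ t y‖ₑ ^ 2) + 2 * ∫⁻ y in ball z 1, ‖u₂ t y‖ₑ ^ 2 := by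
          have m₁ : AEMeasurable (fun y => ‖u₁ t y‖ₑ ^ 2) (volume.restrict (ball z 1)) := (hu₁.enorm.pow_const 2).restrict
          have m₂ : AEMeasurable (fun y => ‖u₂ t y‖ₑ ^ 2) (volume.restrict (ball z 1)) := (hu₂.enorm.pow_const 2).restrict
          have m₁' : AEMeasurable (fun y => 2 * ‖u₁ t y‖ₑ ^ 2) (volume.restrict (ball z 1)) := m₁.const_mul _
          rw [lintegral_add_left' m₁', lintegral_const_mul'' _ m₁, lintegral_const_mul'' _ m₂]
      _ ≤ 2 * A + 2 * A := add_le_add (mul_le_mul' le_rfl (hA₁ z)) (mul_le_mul' le_rfl (hA₂ z))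
  have hα2t : α2 ≠ ⊤ := ne_top_of_le_ne_top (by finiteness) hα2A
  have hαW : ∀ z, ∫⁻ y in ball z 1, ‖W y‖ₑ ^ 2 ≤ α2 := fun z => le_iSup (fun z => ∫⁻ y in ball z 1, ‖W y‖ₑ ^ 2) z
  have hαWr : ∀ z, ∫⁻ y in ball z r, ‖W y‖ₑ ^ 2 ≤ α2 := fun z =>
    (lintegral_mono_set (ball_subset_ball hr1)).trans (hαW z)
  have hEα : E ≤ N * α2 := hN volume (fun y => ‖W y‖ₑ ^ 2) x₀
  have hEt : E ≠ ⊤ := ne_top_of_le_ne_top (ENNReal.mul_ne_top ENNReal.coe_ne_top hα2t) hEα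
  have hEr : ∫⁻ y in ball x₀ r, ‖W y‖ₑ ^ 2 ≤ E := lintegral_mono_set hBr_S
  have hKt : K ≠ ⊤ := by
    have h4 : (4 : ℝ≥0∞) ≠ ⊤ := ENNReal.ofNat_ne_top
    refine ne_top_of_le_ne_top (ENNReal.add_ne_top.2 ⟨ENNReal.mul_ne_top h4 h3₁, ENNReal.mul_ne_top h4 h3₂⟩)
      (?_ : K ≤ (4 * ∫⁻ y in S, ‖u₁ t y‖ₑ ^ (3 : ℕ)) + 4 * ∫⁻ y in S, ‖u₂ t y‖ₑ ^ (3 : ℕ))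
    calc K ≤ ∫⁻ y in S, (4 * ‖u₁ t y‖ₑ ^ (3 : ℕ) + 4 * ‖u₂ t y‖ₑ ^ (3 : ℕ)) := by
          refine lintegral_mono fun y => ?_
          calc ‖W y‖ₑ ^ (3 : ℕ) ≤ (‖u₁ t y‖ₑ + ‖u₂ t y‖ₑ) ^ (3 : ℕ) := by
                gcongr
                exact enorm_sub_le
            _ ≤ 4 * ‖u₁ t y‖ₑ ^ (3 : ℕ) + 4 * ‖u₂ t y‖ₑ ^ (3 : ℕ) := ennreal_add_pow_three_le_four_mul_add _ _
      _ = (4 * ∫⁻ y in S, ‖u₁ t y‖ₑ ^ (3 : ℕ)) + 4 * ∫⁻ y in S, ‖u₂ t y‖ₑ ^ (3 : ℕ) := by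
          have m₁ : AEMeasurable (fun y => ‖u₁ t y‖ₑ ^ (3 : ℕ)) (volume.restrict S) := (hu₁.enorm.pow_const 3).restrict
          have m₂ : AEMeasurable (fun y => ‖u₂ t y‖ₑ ^ (3 : ℕ)) (volume.restrict S) := (hu₂.enorm.pow_const 3).restrict
          have m₁' : AEMeasurable (fun y => 4 * ‖u₁ t y‖ₑ ^ (3 : ℕ)) (volume.restrict S) := m₁.const_mul _
          rw [lintegral_add_left' m₁', lintegral_const_mul'' _ m₁, lintegral_const_mul'' _ m₂]
  have hKr : ∫⁻ y in ball x₀ r, ‖W y‖ₑ ^ (3 : ℕ) ≤ K := lintegral_mono_set hBr_S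
  -- ## the test pairing
  have hg2 : (∫⁻ x, ‖g x‖ₑ ^ (2 : ℝ)) ^ (1 / 2 : ℝ) ≤ Bₑ * E ^ (1 / 2 : ℝ) := by
    have h := lintegral_enorm_inner_rpow_le (W := W) hψB hψ0 (q := 2) two_pos
    calc (∫⁻ x, ‖g x‖ₑ ^ (2 : ℝ)) ^ (1 / 2 : ℝ)
        ≤ (Bₑ ^ (2 : ℝ) * ∫⁻ x in ball x₀ r, ‖W x‖ₑ ^ (2 : ℝ)) ^ (1 / 2 : ℝ) := ENNReal.rpow_le_rpow h (by norm_num)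
      _ = Bₑ * (∫⁻ x in ball x₀ r, ‖W x‖ₑ ^ 2) ^ (1 / 2 : ℝ) := by
          rw [ENNReal.mul_rpow_of_nonneg _ _ (by norm_num), ← ENNReal.rpow_mul]
          norm_num
      _ ≤ Bₑ * E ^ (1 / 2 : ℝ) := by gcongr
  have hg3 : (∫⁻ x, ‖g x‖ₑ ^ (3 : ℝ)) ^ (1 / 3 : ℝ) ≤ Bₑ * K ^ (1 / 3 : ℝ) := by
    have h := lintegral_enorm_inner_rpow_le (W := W) hψB hψ0 (q := 3) (by norm_num)
    calc (∫⁻ x, ‖g x‖ₑ ^ (3 : ℝ)) ^ (1 / 3 : ℝ)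
        ≤ (Bₑ ^ (3 : ℝ) * ∫⁻ x in ball x₀ r, ‖W x‖ₑ ^ (3 : ℝ)) ^ (1 / 3 : ℝ) := ENNReal.rpow_le_rpow h (by norm_num)
      _ = Bₑ * (∫⁻ x in ball x₀ r, ‖W x‖ₑ ^ (3 : ℕ)) ^ (1 / 3 : ℝ) := by
          rw [ENNReal.mul_rpow_of_nonneg _ _ (by norm_num), ← ENNReal.rpow_mul]
          norm_num
      _ ≤ Bₑ * K ^ (1 / 3 : ℝ) := by gcongr
  have hg2t : (∫⁻ x, ‖g x‖ₑ ^ (2 : ℝ)) ^ (1 / 2 : ℝ) ≠ ⊤ :=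
    ne_top_of_le_ne_top (ENNReal.mul_ne_top ENNReal.ofReal_ne_top (ENNReal.rpow_ne_top_of_nonneg (by norm_num) hEt)) hg2
  have hg3t : (∫⁻ x, ‖g x‖ₑ ^ (3 : ℝ)) ^ (1 / 3 : ℝ) ≠ ⊤ :=
    ne_top_of_le_ne_top (ENNReal.mul_ne_top ENNReal.ofReal_ne_top (ENNReal.rpow_ne_top_of_nonneg (by norm_num) hKt)) hg3
  have hg1 : ∫⁻ x, ‖g x‖ₑ ≤ Bₑ * ∫⁻ x in ball x₀ r, ‖W x‖ₑ := lintegral_enorm_inner_le_of_testField (W := W) hψB hψ0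
  -- `g` is integrable
  have hWr1 : ∫⁻ x in ball x₀ r, ‖W x‖ₑ ≤ Vr ^ (1 / 2 : ℝ) * E ^ (1 / 2 : ℝ) := by
    have h := lintegral_ball_enorm_le_sqrt hWm x₀ r
    rw [Measure.addHaar_ball_center volume x₀ r] at h
    exact h.trans (mul_le_mul' le_rfl (ENNReal.rpow_le_rpow hEr (by norm_num)))
  have hgi : Integrable g volume := by
    refine ⟨hgm, ?_⟩
    refine lt_of_le_of_lt (hg1.trans (mul_le_mul' le_rfl hWr1)) ?_
    exact ENNReal.mul_lt_top ENNReal.ofReal_lt_top (ENNReal.mul_lt_top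
      (ENNReal.rpow_lt_top_of_nonneg (by norm_num) hVrt) (ENNReal.rpow_lt_top_of_nonneg (by norm_num) hEt))
  -- ## the near field: the Calderón–Zygmund decomposition
  set a : EuclideanSpace ℝ (Fin 3) → EuclideanSpace ℝ (Fin 3) := S.indicator (u₁ t) with ha
  set b : EuclideanSpace ℝ (Fin 3) → EuclideanSpace ℝ (Fin 3) := S.indicator (u₂ t) with hb
  set e : EuclideanSpace ℝ (Fin 3) → EuclideanSpace ℝ (Fin 3) := S.indicator (u₃ t) with he
  have ham : AEStronglyMeasurable a volume := hu₁.indicator hSm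
  have hbm : AEStronglyMeasurable b volume := hu₂.indicator hSm
  have hem : AEStronglyMeasurable e volume := hu₃.indicator hSm
  obtain ⟨ha2, -⟩ := memLp_normSq_indicator hSm hu₁ h3₁
  obtain ⟨hb2, -⟩ := memLp_normSq_indicator hSm hu₂ h3₂
  have hab : ∀ y, a y - b y = S.indicator W y := fun y => by
    simp only [ha, hb, hW]
    by_cases hy : y ∈ S
    · simp [indicator_of_mem hy]
    · simp [indicator_of_notMem hy]
  have hae : ∀ y, a y - e y = S.indicator (fun x => u₁ t x - u₃ t x) y := fun y => by
    simp only [ha, he]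
    by_cases hy : y ∈ S
    · simp [indicator_of_mem hy]
    · simp [indicator_of_notMem hy]
  -- `|a-b||e| ∈ L²`, norm `≤ m E^{1/2}`
  obtain ⟨hce, hce_le⟩ := memLp_two_norm_mul_norm_of_bound hSm hWm hu₃ hm hm₃ hEt
  have hce' : MemLp (fun y => ‖a y - b y‖ * ‖e y‖) 2 volume := by
    refine hce.ae_eq (Eventually.of_forall fun y => ?_)
    simp only [hab, he]
  have hce_le' : eLpNorm (fun y => ‖a y - b y‖ * ‖e y‖) 2 volume ≤ ENNReal.ofReal m * E ^ (1 / 2 : ℝ) := by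
    have e1 : (fun y => ‖a y - b y‖ * ‖e y‖) = fun y => ‖S.indicator W y‖ * ‖S.indicator (u₃ t) y‖ := by
      funext y; rw [hab]
    rw [e1]
    exact hce_le
  -- `|a-b||a-e| ∈ L²`, norm `≤ L6 ε`
  have hu13 : AEStronglyMeasurable (fun x => u₁ t x - u₃ t x) volume := hu₁.sub hu₃
  have hε₄t : eLpNorm (fun x => u₁ t x - u₃ t x) 3 volume ≠ ⊤ := ne_top_of_le_ne_top ENNReal.ofReal_ne_top hε₄
  obtain ⟨hcd, hcd_le⟩ := memLp_two_norm_mul_norm_of_L6_L3 hSm hWm hu13 h6 hε₄t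
  have hcd' : MemLp (fun y => ‖a y - b y‖ * ‖a y - e y‖) 2 volume := by
    refine hcd.ae_eq (Eventually.of_forall fun y => ?_)
    simp only [hab, hae]
  have hcd_le' : eLpNorm (fun y => ‖a y - b y‖ * ‖a y - e y‖) 2 volume ≤ L6 * ENNReal.ofReal ε := by
    have e1 : (fun y => ‖a y - b y‖ * ‖a y - e y‖) = fun y => ‖S.indicator W y‖ * ‖S.indicator (fun x => u₁ t x - u₃ t x) y‖ := by
      funext y; rw [hab, hae]
    rw [e1]
    exact hcd_le.trans (mul_le_mul' le_rfl hε₄)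
  -- `‖|a - b|²‖_{3/2} = K^{2/3}`
  have hcc_eq : eLpNorm (fun y => ‖a y - b y‖ ^ 2) (3 / 2 : ℝ≥0∞) volume = K ^ (2 / 3 : ℝ) := by
    obtain ⟨-, h⟩ := memLp_normSq_indicator hSm hWm (ne_top_of_le_ne_top hKt le_rfl)
    have e1 : (fun y => ‖a y - b y‖ ^ 2) = fun y => ‖S.indicator W y‖ ^ 2 := by
      funext y; rw [hab]
    rw [e1, h]
  obtain ⟨Q₁, Q₂, Q₃, hQ₁m, hQ₂m, hQ₃m, hQ, hQ₁b, hQ₂b, hQ₃b⟩ :=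
    hCcz a b e ham hbm hem ha2 hb2 hce' hcd'
  -- ## the three near-field pairings
  obtain ⟨hI₁, hP₁⟩ := integrable_and_enorm_integral_le hQ₁m hgm (lintegral_enorm_mul_le_L2 hQ₁m hgm)
    (ENNReal.mul_ne_top (ne_top_of_le_ne_top (ENNReal.mul_ne_top ENNReal.coe_ne_top
      (ne_top_of_le_ne_top (ENNReal.mul_ne_top ENNReal.ofReal_ne_top
        (ENNReal.rpow_ne_top_of_nonneg (by norm_num) hEt)) hce_le')) hQ₁b) hg2t)
  obtain ⟨hI₂, hP₂⟩ := integrable_and_enorm_integral_le hQ₂m hgm (lintegral_enorm_mul_le_L2 hQ₂m hgm)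
    (ENNReal.mul_ne_top (ne_top_of_le_ne_top (ENNReal.mul_ne_top ENNReal.coe_ne_top
      (ne_top_of_le_ne_top (ENNReal.mul_ne_top h6 ENNReal.ofReal_ne_top) hcd_le')) hQ₂b) hg2t)
  obtain ⟨hI₃, hP₃⟩ := integrable_and_enorm_integral_le hQ₃m hgm (lintegral_enorm_mul_le_L32 hQ₃m hgm)
    (ENNReal.mul_ne_top (ne_top_of_le_ne_top (ENNReal.mul_ne_top ENNReal.coe_ne_top
      (by rw [hcc_eq]; exact ENNReal.rpow_ne_top_of_nonneg (by norm_num) hKt)) hQ₃b) hg3t)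
  -- ## the far field (balls of radius `r`)
  have hWA : ∀ z, ∫⁻ y in ball z r, ‖W y‖ₑ ≤ V₁ ^ (1 / 2 : ℝ) * α2 ^ (1 / 2 : ℝ) := fun z => by
    have h := lintegral_ball_enorm_le_sqrt hWm z r
    rw [Measure.addHaar_ball_center volume z r] at h
    exact h.trans (mul_le_mul' le_rfl (ENNReal.rpow_le_rpow (hαWr z) (by norm_num)))
  have hWU : ∀ z, ∫⁻ y in ball z r, ‖W y‖ₑ * ‖u₁ t y - u₃ t y‖ₑ ≤ V₁ ^ (1 / 6 : ℝ) * α2 ^ (1 / 2 : ℝ) * ENNReal.ofReal ε :=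
    fun z => by
    have h := lintegral_ball_enorm_mul_enorm_le hWm hu13 z r
    rw [Measure.addHaar_ball_center volume z r] at h
    exact h.trans (mul_le_mul' (mul_le_mul' le_rfl (ENNReal.rpow_le_rpow (hαWr z) (by norm_num))) hε₄)
  have htail₁ : ∫⁻ y in Sᶜ, ‖W y‖ₑ * ENNReal.ofReal ((‖y - x₀‖ ^ 4)⁻¹) ≤ τ * (V₁ ^ (1 / 2 : ℝ) * α2 ^ (1 / 2 : ℝ)) := by
    have h := hKtail (fun y => ‖W y‖ₑ) hWm.enorm _ hWA x₀ (2 * r) (by linarith)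
    simpa only [hτ, mul_assoc] using h
  have htail₂ : ∫⁻ y in Sᶜ, ‖W y‖ₑ * ‖u₁ t y - u₃ t y‖ₑ * ENNReal.ofReal ((‖y - x₀‖ ^ 4)⁻¹) ≤
      τ * (V₁ ^ (1 / 6 : ℝ) * α2 ^ (1 / 2 : ℝ) * ENNReal.ofReal ε) := by
    have h := hKtail (fun y => ‖W y‖ₑ * ‖u₁ t y - u₃ t y‖ₑ) (hWm.enorm.mul hu13.enorm) _ hWU x₀ (2 * r) (by linarith)
    simpa only [hτ, mul_assoc] using h
  -- the pointwise bound of the far-field integrand of the difference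
  set J : ℝ≥0∞ := ∫⁻ y in Sᶜ, ‖u₁ t y - u₂ t y‖ₑ * ‖u₁ t y + u₂ t y‖ₑ * ENNReal.ofReal ((‖y - x₀‖ ^ 4)⁻¹) with hJ
  have hJle : J ≤ 2 * ENNReal.ofReal m * (∫⁻ y in Sᶜ, ‖W y‖ₑ * ENNReal.ofReal ((‖y - x₀‖ ^ 4)⁻¹)) +
      2 * (∫⁻ y in Sᶜ, ‖W y‖ₑ * ‖u₁ t y - u₃ t y‖ₑ * ENNReal.ofReal ((‖y - x₀‖ ^ 4)⁻¹)) + TW := by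
    have hpt : ∀ᵐ y ∂(volume.restrict Sᶜ), ‖u₁ t y - u₂ t y‖ₑ * ‖u₁ t y + u₂ t y‖ₑ * ENNReal.ofReal ((‖y - x₀‖ ^ 4)⁻¹) ≤
        2 * ENNReal.ofReal m * (‖W y‖ₑ * ENNReal.ofReal ((‖y - x₀‖ ^ 4)⁻¹)) +
          2 * (‖W y‖ₑ * ‖u₁ t y - u₃ t y‖ₑ * ENNReal.ofReal ((‖y - x₀‖ ^ 4)⁻¹)) +
          ‖W y‖ₑ ^ 2 * ENNReal.ofReal ((‖y - x₀‖ ^ 4)⁻¹) := by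
      filter_upwards [ae_restrict_of_ae (s := Sᶜ) hm₃] with y hy
      have hsum : u₁ t y + u₂ t y = (2 : ℝ) • u₃ t y + (2 : ℝ) • (u₁ t y - u₃ t y) - W y := by
        simp only [hW, two_smul]; abel
      have hn : ‖u₁ t y + u₂ t y‖ₑ ≤ 2 * ENNReal.ofReal m + 2 * ‖u₁ t y - u₃ t y‖ₑ + ‖W y‖ₑ := by
        rw [hsum]
        calc ‖(2 : ℝ) • u₃ t y + (2 : ℝ) • (u₁ t y - u₃ t y) - W y‖ₑ
            ≤ ‖(2 : ℝ) • u₃ t y + (2 : ℝ) • (u₁ t y - u₃ t y)‖ₑ + ‖W y‖ₑ := enorm_sub_le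
          _ ≤ ‖(2 : ℝ) • u₃ t y‖ₑ + ‖(2 : ℝ) • (u₁ t y - u₃ t y)‖ₑ + ‖W y‖ₑ := by
              gcongr; exact enorm_add_le _ _
          _ = 2 * ‖u₃ t y‖ₑ + 2 * ‖u₁ t y - u₃ t y‖ₑ + ‖W y‖ₑ := by
              rw [enorm_smul, enorm_smul, show ‖(2 : ℝ)‖ₑ = 2 from by
                rw [Real.enorm_eq_ofReal zero_le_two, ENNReal.ofReal_ofNat]]
          _ ≤ 2 * ENNReal.ofReal m + 2 * ‖u₁ t y - u₃ t y‖ₑ + ‖W y‖ₑ := by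
              gcongr
              rw [← ofReal_norm]
              exact ENNReal.ofReal_le_ofReal hy
      calc ‖u₁ t y - u₂ t y‖ₑ * ‖u₁ t y + u₂ t y‖ₑ * ENNReal.ofReal ((‖y - x₀‖ ^ 4)⁻¹)
          ≤ ‖W y‖ₑ * (2 * ENNReal.ofReal m + 2 * ‖u₁ t y - u₃ t y‖ₑ + ‖W y‖ₑ) * ENNReal.ofReal ((‖y - x₀‖ ^ 4)⁻¹) := by
            gcongr
        _ = _ := by ring
    calc J ≤ ∫⁻ y in Sᶜ, (2 * ENNReal.ofReal m * (‖W y‖ₑ * ENNReal.ofReal ((‖y - x₀‖ ^ 4)⁻¹)) +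
          2 * (‖W y‖ₑ * ‖u₁ t y - u₃ t y‖ₑ * ENNReal.ofReal ((‖y - x₀‖ ^ 4)⁻¹)) +
          ‖W y‖ₑ ^ 2 * ENNReal.ofReal ((‖y - x₀‖ ^ 4)⁻¹)) := lintegral_mono_ae hpt
      _ = _ := by
          have hk : AEMeasurable (fun y : EuclideanSpace ℝ (Fin 3) => ENNReal.ofReal ((‖y - x₀‖ ^ 4)⁻¹)) (volume.restrict Sᶜ) :=
            (measurable_ofReal_inv_norm_pow_four x₀).aemeasurable
          have mk1 : AEMeasurable (fun y => ‖W y‖ₑ * ENNReal.ofReal ((‖y - x₀‖ ^ 4)⁻¹)) (volume.restrict Sᶜ) :=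
            hWm.enorm.restrict.mul hk
          have mk2 : AEMeasurable (fun y => ‖W y‖ₑ * ‖u₁ t y - u₃ t y‖ₑ * ENNReal.ofReal ((‖y - x₀‖ ^ 4)⁻¹)) (volume.restrict Sᶜ) :=
            (hWm.enorm.restrict.mul hu13.enorm.restrict).mul hk
          have m1 : AEMeasurable (fun y => 2 * ENNReal.ofReal m * (‖W y‖ₑ * ENNReal.ofReal ((‖y - x₀‖ ^ 4)⁻¹))) (volume.restrict Sᶜ) :=
            mk1.const_mul _
          have m2 : AEMeasurable (fun y => 2 * (‖W y‖ₑ * ‖u₁ t y - u₃ t y‖ₑ * ENNReal.ofReal ((‖y - x₀‖ ^ 4)⁻¹))) (volume.restrict Sᶜ) :=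
            mk2.const_mul _
          have m12 : AEMeasurable (fun y => 2 * ENNReal.ofReal m * (‖W y‖ₑ * ENNReal.ofReal ((‖y - x₀‖ ^ 4)⁻¹)) +
              2 * (‖W y‖ₑ * ‖u₁ t y - u₃ t y‖ₑ * ENNReal.ofReal ((‖y - x₀‖ ^ 4)⁻¹))) (volume.restrict Sᶜ) := m1.add m2
          rw [lintegral_add_left' m12, lintegral_add_left' m1, lintegral_const_mul'' _ mk1,
            lintegral_const_mul'' _ mk2]
  have hJbound : J ≤ 2 * ENNReal.ofReal m * (τ * (V₁ ^ (1 / 2 : ℝ) * α2 ^ (1 / 2 : ℝ))) +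
      2 * (τ * (V₁ ^ (1 / 6 : ℝ) * α2 ^ (1 / 2 : ℝ) * ENNReal.ofReal ε)) + TW :=
    hJle.trans (by gcongr)
  -- pointwise bound of `π_far[U₁] - π_far[U₂]` on `B_r(x₀)` and the far-field pairing
  have hFpt : ∀ x ∈ ball x₀ r, ‖localPressureFar x₀ r u₁ t x - localPressureFar x₀ r u₂ t x‖ₑ ≤ cK * J :=
    fun x hx => enorm_localPressureFar_sub_le_of_le_one hCK0 hCK hu₁ hu₂ hAt hA₁ hA₂ hr0 hr1 hx
  set Fd : EuclideanSpace ℝ (Fin 3) → ℝ := fun x => localPressureFar x₀ r u₁ t x - localPressureFar x₀ r u₂ t x with hFd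
  have hFdm : AEStronglyMeasurable Fd volume := hF₁.sub hF₂
  have hFg_pt : ∀ x, ‖Fd x * g x‖ₑ ≤ cK * J * (Bₑ * (ball x₀ r).indicator (fun x => ‖W x‖ₑ) x) := by
    intro x
    rw [enorm_mul]
    by_cases hx : x ∈ ball x₀ r
    · exact mul_le_mul' (hFpt x hx) (enorm_inner_le_indicator (W := W) hψB hψ0 x)
    · have : g x = 0 := by simp only [hg, hψ0 x hx, inner_zero_right]
      rw [this, enorm_zero, mul_zero]
      exact bot_le
  have hJt : J ≠ ⊤ := by
    refine ne_top_of_le_ne_top ?_ hJbound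
    have hTWt : TW ≠ ⊤ := (lintegral_compl_ball_sq_mul_lt_top_of_le_one hWm hα2t hαW hr0 hr1 x₀).ne
    have : α2 ^ (1 / 2 : ℝ) ≠ ⊤ := ENNReal.rpow_ne_top_of_nonneg (by norm_num) hα2t
    have : V₁ ^ (1 / 2 : ℝ) ≠ ⊤ := ENNReal.rpow_ne_top_of_nonneg (by norm_num) hV₁t
    have : V₁ ^ (1 / 6 : ℝ) ≠ ⊤ := ENNReal.rpow_ne_top_of_nonneg (by norm_num) hV₁t
    finiteness
  have hFg_lint : ∫⁻ x, ‖Fd x * g x‖ₑ ≤ cK * J * (Bₑ * ∫⁻ x in ball x₀ r, ‖W x‖ₑ) := by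
    calc ∫⁻ x, ‖Fd x * g x‖ₑ ≤ ∫⁻ x, cK * J * (Bₑ * (ball x₀ r).indicator (fun x => ‖W x‖ₑ) x) :=
          lintegral_mono fun x => hFg_pt x
      _ = cK * J * (Bₑ * ∫⁻ x in ball x₀ r, ‖W x‖ₑ) := by
          rw [lintegral_const_mul' _ _ (ENNReal.mul_ne_top ENNReal.ofReal_ne_top hJt),
            lintegral_const_mul' _ _ ENNReal.ofReal_ne_top, lintegral_indicator measurableSet_ball]
  obtain ⟨hI₄, hP₄⟩ := integrable_and_enorm_integral_le hFdm hgm hFg_lint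
    (ENNReal.mul_ne_top (ENNReal.mul_ne_top ENNReal.ofReal_ne_top hJt) (ENNReal.mul_ne_top ENNReal.ofReal_ne_top
      (ne_top_of_le_ne_top (ENNReal.mul_ne_top (ENNReal.rpow_ne_top_of_nonneg (by norm_num) hVrt)
        (ENNReal.rpow_ne_top_of_nonneg (by norm_num) hEt)) hWr1)))
  -- ## the identity `∫(p₁-p₂)g = ∫(Q₁+Q₂+Q₃)g + ∫Fd g + (κ₁-κ₂)∫g`
  have hnear₁ : ∀ x, localPressureNear x₀ r u₁ t x = normalisedPressure a x := fun x => localPressureNear_apply _ _ _ _ _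
  have hnear₂ : ∀ x, localPressureNear x₀ r u₂ t x = normalisedPressure b x := fun x => localPressureNear_apply _ _ _ _ _
  have hrep₁' := (ae_restrict_iff' (measurableSet_ball (x := x₀) (ε := r))).1 hrep₁
  have hrep₂' := (ae_restrict_iff' (measurableSet_ball (x := x₀) (ε := r))).1 hrep₂
  have hident : (fun x => (p₁ t x - p₂ t x) * g x) =ᵐ[volume]
      fun x => (Q₁ x * g x + Q₂ x * g x + Q₃ x * g x) + Fd x * g x + (κ₁ - κ₂) * g x := by
    filter_upwards [hrep₁', hrep₂', hQ] with x h₁ h₂ hQx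
    by_cases hx : x ∈ ball x₀ r
    · have e1 : p₁ t x - p₂ t x = (normalisedPressure a x - normalisedPressure b x) + Fd x + (κ₁ - κ₂) := by
        rw [h₁ hx, h₂ hx, hnear₁, hnear₂]
        simp only [hFd]
        ring
      have hQx' : normalisedPressure a x - normalisedPressure b x = Q₁ x + Q₂ x + Q₃ x := by
        simpa using hQx
      rw [e1, hQx']
      ring
    · have : g x = 0 := by simp only [hg, hψ0 x hx, inner_zero_right]
      simp only [this, mul_zero, add_zero]
  have hI12 : Integrable (fun x => Q₁ x * g x + Q₂ x * g x) volume := hI₁.add hI₂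
  have hI123 : Integrable (fun x => Q₁ x * g x + Q₂ x * g x + Q₃ x * g x) volume := hI12.add hI₃
  have hI1234 : Integrable (fun x => Q₁ x * g x + Q₂ x * g x + Q₃ x * g x + Fd x * g x) volume := hI123.add hI₄
  have hIκ : Integrable (fun x => (κ₁ - κ₂) * g x) volume := hgi.const_mul _
  have hsplit : ∫ x, (p₁ t x - p₂ t x) * g x =
      ((∫ x, Q₁ x * g x) + (∫ x, Q₂ x * g x) + ∫ x, Q₃ x * g x) + ∫ x, Fd x * g x := by
    rw [integral_congr_ae hident, integral_add hI1234 hIκ, integral_add hI123 hI₄,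
      integral_add hI12 hI₃, integral_add hI₁ hI₂, integral_const_mul]
    have h0 : ∫ x, g x = 0 := hdiv
    rw [h0, mul_zero, add_zero]
  -- ## assembling the bound
  have hmain : ‖∫ x, (p₁ t x - p₂ t x) * g x‖ₑ ≤
      (eLpNorm Q₁ 2 volume * (∫⁻ x, ‖g x‖ₑ ^ (2 : ℝ)) ^ (1 / 2 : ℝ) +
        eLpNorm Q₂ 2 volume * (∫⁻ x, ‖g x‖ₑ ^ (2 : ℝ)) ^ (1 / 2 : ℝ) +
        eLpNorm Q₃ (3 / 2 : ℝ≥0∞) volume * (∫⁻ x, ‖g x‖ₑ ^ (3 : ℝ)) ^ (1 / 3 : ℝ)) +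
      cK * J * (Bₑ * ∫⁻ x in ball x₀ r, ‖W x‖ₑ) := by
    rw [hsplit]
    calc ‖((∫ x, Q₁ x * g x) + (∫ x, Q₂ x * g x) + ∫ x, Q₃ x * g x) + ∫ x, Fd x * g x‖ₑ
        ≤ ‖(∫ x, Q₁ x * g x) + (∫ x, Q₂ x * g x) + ∫ x, Q₃ x * g x‖ₑ + ‖∫ x, Fd x * g x‖ₑ := enorm_add_le _ _
      _ ≤ (‖(∫ x, Q₁ x * g x) + ∫ x, Q₂ x * g x‖ₑ + ‖∫ x, Q₃ x * g x‖ₑ) + ‖∫ x, Fd x * g x‖ₑ := by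
          gcongr; exact enorm_add_le _ _
      _ ≤ (‖∫ x, Q₁ x * g x‖ₑ + ‖∫ x, Q₂ x * g x‖ₑ + ‖∫ x, Q₃ x * g x‖ₑ) + ‖∫ x, Fd x * g x‖ₑ := by
          gcongr; exact enorm_add_le _ _
      _ ≤ _ := add_le_add (add_le_add (add_le_add hP₁ hP₂) hP₃) hP₄
  -- the near-field terms
  have hT₁ : eLpNorm Q₁ 2 volume * (∫⁻ x, ‖g x‖ₑ ^ (2 : ℝ)) ^ (1 / 2 : ℝ) ≤ Cn * (ENNReal.ofReal m * E) := by
    calc eLpNorm Q₁ 2 volume * (∫⁻ x, ‖g x‖ₑ ^ (2 : ℝ)) ^ (1 / 2 : ℝ)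
        ≤ ((Ccz : ℝ≥0∞) * (ENNReal.ofReal m * E ^ (1 / 2 : ℝ))) * (Bₑ * E ^ (1 / 2 : ℝ)) :=
          mul_le_mul' (hQ₁b.trans (mul_le_mul' le_rfl hce_le')) hg2
      _ = Cn * (ENNReal.ofReal m * (E ^ (1 / 2 : ℝ) * E ^ (1 / 2 : ℝ))) := by simp only [hCn]; ring
      _ = Cn * (ENNReal.ofReal m * E) := by
          rw [← ENNReal.rpow_add_of_nonneg _ _ (by norm_num) (by norm_num)]; norm_num
  have hT₂ : eLpNorm Q₂ 2 volume * (∫⁻ x, ‖g x‖ₑ ^ (2 : ℝ)) ^ (1 / 2 : ℝ) ≤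
      Cn * (ENNReal.ofReal ε * L6 * E ^ (1 / 2 : ℝ)) := by
    calc eLpNorm Q₂ 2 volume * (∫⁻ x, ‖g x‖ₑ ^ (2 : ℝ)) ^ (1 / 2 : ℝ)
        ≤ ((Ccz : ℝ≥0∞) * (L6 * ENNReal.ofReal ε)) * (Bₑ * E ^ (1 / 2 : ℝ)) :=
          mul_le_mul' (hQ₂b.trans (mul_le_mul' le_rfl hcd_le')) hg2
      _ = Cn * (ENNReal.ofReal ε * L6 * E ^ (1 / 2 : ℝ)) := by simp only [hCn]; ring
  have hT₃ : eLpNorm Q₃ (3 / 2 : ℝ≥0∞) volume * (∫⁻ x, ‖g x‖ₑ ^ (3 : ℝ)) ^ (1 / 3 : ℝ) ≤ Cn * K := by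
    calc eLpNorm Q₃ (3 / 2 : ℝ≥0∞) volume * (∫⁻ x, ‖g x‖ₑ ^ (3 : ℝ)) ^ (1 / 3 : ℝ)
        ≤ ((Ccz : ℝ≥0∞) * K ^ (2 / 3 : ℝ)) * (Bₑ * K ^ (1 / 3 : ℝ)) := by
          refine mul_le_mul' (hQ₃b.trans ?_) hg3
          rw [hcc_eq]
      _ = Cn * (K ^ (2 / 3 : ℝ) * K ^ (1 / 3 : ℝ)) := by simp only [hCn]; ring
      _ = Cn * K := by
          rw [← ENNReal.rpow_add_of_nonneg _ _ (by norm_num) (by norm_num)]; norm_num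
  -- the far-field term, local form: `∫_{B_r}|W| ≤ |B_r|^{1/2} E^{1/2}`
  set P : ℝ≥0∞ := Bₑ * ∫⁻ x in ball x₀ r, ‖W x‖ₑ with hPdef
  have hPE : P ≤ Bₑ * Vr ^ (1 / 2 : ℝ) * E ^ (1 / 2 : ℝ) := by
    rw [hPdef, mul_assoc]; exact mul_le_mul' le_rfl hWr1
  set X₁ : ℝ≥0∞ := 2 * ENNReal.ofReal m * (τ * (V₁ ^ (1 / 2 : ℝ) * α2 ^ (1 / 2 : ℝ))) with hX₁
  set X₂ : ℝ≥0∞ := 2 * (τ * (V₁ ^ (1 / 6 : ℝ) * α2 ^ (1 / 2 : ℝ) * ENNReal.ofReal ε)) with hX₂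
  have hcoef₁ : cK * (2 * τ * V₁ ^ (1 / 2 : ℝ)) * (Bₑ * Vr ^ (1 / 2 : ℝ)) ≤ Cf := by
    simp only [hCf]
    refine mul_le_mul' (mul_le_mul' le_rfl ?_) le_rfl
    exact le_add_right (le_add_right le_rfl)
  have hcoef₂ : cK * (2 * τ * V₁ ^ (1 / 6 : ℝ)) * (Bₑ * Vr ^ (1 / 2 : ℝ)) ≤ Cf := by
    simp only [hCf]
    refine mul_le_mul' (mul_le_mul' le_rfl ?_) le_rfl
    exact le_add_right le_add_self
  have hcoef₃ : cK * 1 * (Bₑ * Vr ^ (1 / 2 : ℝ)) ≤ Cf := by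
    simp only [hCf]
    refine mul_le_mul' (mul_le_mul' le_rfl ?_) le_rfl
    exact le_add_self
  have hT₄ : cK * J * P ≤
      Cf * ((ENNReal.ofReal m * α2 ^ (1 / 2 : ℝ) + ENNReal.ofReal ε * α2 ^ (1 / 2 : ℝ) + TW) * E ^ (1 / 2 : ℝ)) := by
    calc cK * J * P ≤ cK * (X₁ + X₂ + TW) * (Bₑ * Vr ^ (1 / 2 : ℝ) * E ^ (1 / 2 : ℝ)) := by gcongr
      _ = (cK * (2 * τ * V₁ ^ (1 / 2 : ℝ)) * (Bₑ * Vr ^ (1 / 2 : ℝ))) * (ENNReal.ofReal m * α2 ^ (1 / 2 : ℝ) * E ^ (1 / 2 : ℝ)) +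
          (cK * (2 * τ * V₁ ^ (1 / 6 : ℝ)) * (Bₑ * Vr ^ (1 / 2 : ℝ))) * (ENNReal.ofReal ε * α2 ^ (1 / 2 : ℝ) * E ^ (1 / 2 : ℝ)) +
          (cK * 1 * (Bₑ * Vr ^ (1 / 2 : ℝ))) * (TW * E ^ (1 / 2 : ℝ)) := by
          simp only [hX₁, hX₂]; ring
      _ ≤ Cf * (ENNReal.ofReal m * α2 ^ (1 / 2 : ℝ) * E ^ (1 / 2 : ℝ)) +
          Cf * (ENNReal.ofReal ε * α2 ^ (1 / 2 : ℝ) * E ^ (1 / 2 : ℝ)) + Cf * (TW * E ^ (1 / 2 : ℝ)) :=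
          add_le_add (add_le_add (mul_le_mul' hcoef₁ le_rfl) (mul_le_mul' hcoef₂ le_rfl)) (mul_le_mul' hcoef₃ le_rfl)
      _ = Cf * ((ENNReal.ofReal m * α2 ^ (1 / 2 : ℝ) + ENNReal.ofReal ε * α2 ^ (1 / 2 : ℝ) + TW) * E ^ (1 / 2 : ℝ)) := by
          ring
  -- ## conclusion
  have hCn_le : Cn ≤ C := by simp only [hC]; exact le_add_right (le_add_right le_rfl)
  have hCf_le : Cf ≤ C := by simp only [hC]; exact le_add_right le_add_self
  calc ‖∫ x, (p₁ t x - p₂ t x) * g x‖ₑ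
      ≤ (Cn * (ENNReal.ofReal m * E) + Cn * (ENNReal.ofReal ε * L6 * E ^ (1 / 2 : ℝ)) + Cn * K) +
          Cf * ((ENNReal.ofReal m * α2 ^ (1 / 2 : ℝ) + ENNReal.ofReal ε * α2 ^ (1 / 2 : ℝ) + TW) * E ^ (1 / 2 : ℝ)) :=
        hmain.trans (add_le_add (add_le_add (add_le_add hT₁ hT₂) hT₃) hT₄)
    _ ≤ (C * (ENNReal.ofReal m * E) + C * (ENNReal.ofReal ε * L6 * E ^ (1 / 2 : ℝ)) + C * K) +
          C * ((ENNReal.ofReal m * α2 ^ (1 / 2 : ℝ) + ENNReal.ofReal ε * α2 ^ (1 / 2 : ℝ) + TW) * E ^ (1 / 2 : ℝ)) :=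
        add_le_add (add_le_add (add_le_add (mul_le_mul' hCn_le le_rfl) (mul_le_mul' hCn_le le_rfl))
          (mul_le_mul' hCn_le le_rfl)) (mul_le_mul' hCf_le le_rfl)
    _ = C * (ENNReal.ofReal m * E + ENNReal.ofReal ε * L6 * E ^ (1 / 2 : ℝ) + K +
          (ENNReal.ofReal m * α2 ^ (1 / 2 : ℝ) + ENNReal.ofReal ε * α2 ^ (1 / 2 : ℝ) + TW) * E ^ (1 / 2 : ℝ)) := by ring

end JiaSverak2014

end Literature.Analysis.FluidPDE

end
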